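import Summits.ResolutionOfSingularities.ResolutionOfSingularities.Theorems.FrobeniusLadderFInjectiveMacaulayficationGxzData
import Summits.ResolutionOfSingularities.ResolutionOfSingularities.Theorems.FrobeniusLadderFInjectiveMacaulayficationFedderViaSlicingNotMem
import Summits.ResolutionOfSingularities.ResolutionOfSingularities.Theorems.FrobeniusLadderFInjectiveMacaulayficationT4PlusFedderData
import Summits.ResolutionOfSingularities.ResolutionOfSingularities.Theorems.FrobeniusLadderFInjectiveMacaulayficationG5wConeClause
import HarnessLib

/-!
# `G_xz` (diagonal form `g = z² + x²t⁴ + (y² + x³)³ + w⁷`) at `p = 5`: the off-origin clause `hoff` — Jacobian off `L ∪ C`,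
# Fedder through slicings along the `t`-axis `L` and the cuspidal curve `C`
# (crux `FInjectiveMacaulayfication`, graded engine G5; campaign G_xz/5, RULING R15.14 (1) of res-L1-w45a-plan-1)

Support file for crux stmt-ResolutionOfSingularities-15315 (`FrobeniusLadder.FInjectiveMacaulayfication`), chain w45a, seat
res-L1-w45a-stub-4 g6. [OURS · L1 W4.5a; specimen `G_xz` (res-L1-w45a-idea-2; hand Fedder along `L ∖ 0`, `C ∖ 0` res-L1-w45a-tri-2,
R15.1 (3)); templates `G5wConeClause` / `G5wFilteredFiModel` (res-L1-w45a-stub-3)] — NOT a statement of the manuscript; AI-written,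
weaker than expert review.

Over any field of characteristic `5`, the hypersurface `g = X₂² + X₀²X₄⁴ + (X₁² + X₀³)³ + X₃⁷ ⊂ 𝔸⁵` (`x,y,z,w,t = X₀,…,X₄`) is
singular EXACTLY along `L ∪ C`, `L = V(x,y,z,w)` (the `t`-axis) and `C = V(z,w,t,φ)`, `φ = y² + x³` (ideal-theoretically: all five
partials in a prime `P ∋ g` force `P ⊇ I(L)` or `P ⊇ I(C)`; units `2, 4, 6, 7, 9 mod 5`; at `p = 7` there would be a third component),
and the bad (non-F-pure) locus is the origin alone:

* off `L ∪ C`: some partial `∉ P` ⇒ regular ⇒ clause (`ClauseOfPderivNotMem`);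
* along `L ∖ 0` (`t ∉ P`): AXIS SLICING `k[X₀,…,X₄] ≃ k[t][Y₀,…,Y₃]` (`exists_axisSlicing5`); the `x⁴z⁴`-coefficient of `g⁴` is
  `6·t⁸` EXACTLY (`coeff_along_L`: `coeff_X_pow_add_pow` in `z`, then in `w`, then kill `y` and `x⁵`); `6 ∈ k×`, `t⁸ ∉ 𝔭` ⇒
  `FedderViaSlicing.clause_of_sliceCoeff` (transversal type at a point of `L ∖ 0`: `z² + c·x² + …`, a double point, F-pure);
* along `C ∖ 0` (`x, y ∉ P`): PLANE SLICING `k[X] ≃ k[x,y][Z,W,T]` (`exists_planeSlicing5`); the `z⁴t⁴w⁰`-coefficient of `g⁴` is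
  `12·x²·φ³` EXACTLY (`coeff_along_C`); `12x² ∉ 𝔭` is a unit AT THE POINT only ⇒ the new variant
  `FedderViaSlicingNotMem.clause_of_sliceCoeff_of_not_mem` with `m = 3 ≤ p − 1` and `∂φ/∂y = 2y ∉ 𝔭` (transversal type
  `z² + x²t⁴ + φ³`, Brieskorn–Pham `(2,4,3)`, F-pure at `p = 5` since `z⁴·t⁴·φ³` has exponents `≤ 4`).

Main theorem `gxz_offOrigin_clause_char5` = the hypothesis `hoff` of `GradedConeFiModel.stub_gradedConeFiModel` for `g` at `p = 5`.
All proofs are glue on Mathlib and landed files; no definitions, no named facts. References: [Fedder1983] R. Fedder, *F-purity and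
rational singularity*, Trans. AMS 278 (1983), Thm. 1.12 (through the imported criteria). [folklore]
-/

-- single-problem summit: the doubled namespace component is forced
set_option linter.dupNamespace false

noncomputable section

namespace Summit.ResolutionOfSingularities.ResolutionOfSingularities.Theorems.FInjectiveMacaulayfication.GxzOffOrigin

open MvPolynomial IsLocalRing
open Summit.ResolutionOfSingularities.ResolutionOfSingularities.Theorems.FInjectiveMacaulayfication

/-! ## The two slicings of `k[X₀,…,X₄]` -/

/-- **Axis slicing** `k[X₀,…,X₄] ≃ k[X₄][Y₀,…,Y₃]`: `Xⱼ ↦ Yⱼ` (`j ≤ 3`), `X₄ ↦ C X₀` (base `k[t]` as `MvPolynomial (Fin 1) k`). [folklore] -/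
theorem exists_axisSlicing5 (k : Type) [Field k] :
    ∃ Ψ : MvPolynomial (Fin 5) k ≃+* MvPolynomial (Fin 4) (MvPolynomial (Fin 1) k),
      Ψ (X 0) = X 0 ∧ Ψ (X 1) = X 1 ∧ Ψ (X 2) = X 2 ∧ Ψ (X 3) = X 3 ∧ Ψ (X 4) = C (X 0) := by
  have e0 : (@finSumFinEquiv 4 1).symm 0 = Sum.inl 0 := by decide
  have e1 : (@finSumFinEquiv 4 1).symm 1 = Sum.inl 1 := by decide
  have e2 : (@finSumFinEquiv 4 1).symm 2 = Sum.inl 2 := by decide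
  have e3 : (@finSumFinEquiv 4 1).symm 3 = Sum.inl 3 := by decide
  have e4 : (@finSumFinEquiv 4 1).symm 4 = Sum.inr 0 := by decide
  refine ⟨((renameEquiv k (@finSumFinEquiv 4 1).symm).trans
    (sumAlgEquiv k (Fin 4) (Fin 1))).toRingEquiv, ?_, ?_, ?_, ?_, ?_⟩
  · show sumAlgEquiv k (Fin 4) (Fin 1) (rename _ (X 0)) = _
    rw [rename_X, e0]; exact sumAlgEquiv_X_inl _ _ _ _
  · show sumAlgEquiv k (Fin 4) (Fin 1) (rename _ (X 1)) = _
    rw [rename_X, e1]; exact sumAlgEquiv_X_inl _ _ _ _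
  · show sumAlgEquiv k (Fin 4) (Fin 1) (rename _ (X 2)) = _
    rw [rename_X, e2]; exact sumAlgEquiv_X_inl _ _ _ _
  · show sumAlgEquiv k (Fin 4) (Fin 1) (rename _ (X 3)) = _
    rw [rename_X, e3]; exact sumAlgEquiv_X_inl _ _ _ _
  · show sumAlgEquiv k (Fin 4) (Fin 1) (rename _ (X 4)) = _
    rw [rename_X, e4]; exact sumAlgEquiv_X_inr _ _ _ _

/-- **Plane slicing** `k[X₀,…,X₄] ≃ k[X₀,X₁][Y₀,Y₁,Y₂]`: `X₀ ↦ C X₀`, `X₁ ↦ C X₁`, `X₂ ↦ Y₀`, `X₃ ↦ Y₁`, `X₄ ↦ Y₂`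
(base `k[x,y]`, slices `z, w, t`). [folklore] -/
theorem exists_planeSlicing5 (k : Type) [Field k] :
    ∃ Ψ : MvPolynomial (Fin 5) k ≃+* MvPolynomial (Fin 3) (MvPolynomial (Fin 2) k),
      Ψ (X 0) = C (X 0) ∧ Ψ (X 1) = C (X 1) ∧ Ψ (X 2) = X 0 ∧ Ψ (X 3) = X 1 ∧ Ψ (X 4) = X 2 := by
  have e0 : ((@finSumFinEquiv 2 3).symm.trans (Equiv.sumComm (Fin 2) (Fin 3))) 0 = Sum.inr 0 := by decide
  have e1 : ((@finSumFinEquiv 2 3).symm.trans (Equiv.sumComm (Fin 2) (Fin 3))) 1 = Sum.inr 1 := by decide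
  have e2 : ((@finSumFinEquiv 2 3).symm.trans (Equiv.sumComm (Fin 2) (Fin 3))) 2 = Sum.inl 0 := by decide
  have e3 : ((@finSumFinEquiv 2 3).symm.trans (Equiv.sumComm (Fin 2) (Fin 3))) 3 = Sum.inl 1 := by decide
  have e4 : ((@finSumFinEquiv 2 3).symm.trans (Equiv.sumComm (Fin 2) (Fin 3))) 4 = Sum.inl 2 := by decide
  refine ⟨((renameEquiv k ((@finSumFinEquiv 2 3).symm.trans (Equiv.sumComm (Fin 2) (Fin 3)))).trans
    (sumAlgEquiv k (Fin 3) (Fin 2))).toRingEquiv, ?_, ?_, ?_, ?_, ?_⟩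
  · show sumAlgEquiv k (Fin 3) (Fin 2) (rename _ (X 0)) = _
    rw [rename_X, e0]; exact sumAlgEquiv_X_inr _ _ _ _
  · show sumAlgEquiv k (Fin 3) (Fin 2) (rename _ (X 1)) = _
    rw [rename_X, e1]; exact sumAlgEquiv_X_inr _ _ _ _
  · show sumAlgEquiv k (Fin 3) (Fin 2) (rename _ (X 2)) = _
    rw [rename_X, e2]; exact sumAlgEquiv_X_inl _ _ _ _
  · show sumAlgEquiv k (Fin 3) (Fin 2) (rename _ (X 3)) = _
    rw [rename_X, e3]; exact sumAlgEquiv_X_inl _ _ _ _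
  · show sumAlgEquiv k (Fin 3) (Fin 2) (rename _ (X 4)) = _
    rw [rename_X, e4]; exact sumAlgEquiv_X_inl _ _ _ _

/-! ## The two extracted coefficients of `g⁴` -/

/-- **Along `L`: the `x⁴z⁴`-coefficient of `g⁴` is `6·t⁸`.**  In `k[t][Y₀,…,Y₃]` with `G = Y₂² + u`,
`u = C(t⁴)Y₀² + (Y₁² + Y₀³)³ + Y₃⁷`: `coeff_{z⁴x⁴} G⁴ = C(4,2)·coeff_{x⁴} u²` (binomial in `Y₂`), `= coeff_{x⁴} u′²` with `u′ = u − Y₃⁷`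
(binomial in `Y₃`, `i = 0`), then `y ∣ u′ − (C(t⁴)Y₀² + Y₀⁹)` kills `y` and `(C(t⁴)Y₀² + Y₀⁹)² = C(t⁸)Y₀⁴ + Y₀⁵·(…)`. [folklore] -/
theorem coeff_along_L (k : Type) [Field k] (a : MvPolynomial (Fin 1) k) :
    coeff (Finsupp.single (2 : Fin 4) (2 * 2) + Finsupp.single 0 4)
      ((X 2 ^ 2 + (C a * X 0 ^ 2 + (X 1 ^ 2 + X 0 ^ 3) ^ 3 + X 3 ^ 7) : MvPolynomial (Fin 4) (MvPolynomial (Fin 1) k)) ^ 4) =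
        6 * a ^ 2 := by
  set u : MvPolynomial (Fin 4) (MvPolynomial (Fin 1) k) := C a * X 0 ^ 2 + (X 1 ^ 2 + X 0 ^ 3) ^ 3 + X 3 ^ 7 with hu_def
  have hφdeg : degreeOf 2 (X 1 ^ 2 + X 0 ^ 3 : MvPolynomial (Fin 4) (MvPolynomial (Fin 1) k)) = 0 := by
    apply Nat.eq_zero_of_le_zero
    refine (degreeOf_add_le _ _ _).trans (max_le ?_ ?_) <;>
    · refine (degreeOf_pow_le _ _ _).trans ?_
      rw [degreeOf_X, if_neg (by decide), mul_zero]
  -- binomial in `Y₂`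
  have hu : degreeOf 2 u = 0 := by
    apply Nat.eq_zero_of_le_zero
    refine (degreeOf_add_le _ _ _).trans (max_le ((degreeOf_add_le _ _ _).trans (max_le ?_ ?_)) ?_)
    · refine (degreeOf_mul_le _ _ _).trans ?_
      rw [degreeOf_C, zero_add]
      refine (degreeOf_pow_le _ _ _).trans ?_
      rw [degreeOf_X, if_neg (by decide), mul_zero]
    · refine (degreeOf_pow_le _ _ _).trans ?_
      rw [hφdeg, mul_zero]
    · refine (degreeOf_pow_le _ _ _).trans ?_
      rw [degreeOf_X, if_neg (by decide), mul_zero]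
  rw [FedderViaSlicing.coeff_X_pow_add_pow 2 2 4 2 (by norm_num) (by norm_num) u hu _ (by simp),
    show (4 - 2 : ℕ) = 2 from rfl, show (Nat.choose 4 2 : MvPolynomial (Fin 1) k) = 6 by norm_num [Nat.choose]]
  congr 1
  -- binomial in `Y₃` (`i = 0`)
  set u' : MvPolynomial (Fin 4) (MvPolynomial (Fin 1) k) := C a * X 0 ^ 2 + (X 1 ^ 2 + X 0 ^ 3) ^ 3 with hu'_def
  have hu3 : u = X 3 ^ 7 + u' := by rw [hu_def, hu'_def]; ring
  clear hφdeg
  have hφdeg : degreeOf 3 (X 1 ^ 2 + X 0 ^ 3 : MvPolynomial (Fin 4) (MvPolynomial (Fin 1) k)) = 0 := by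
    apply Nat.eq_zero_of_le_zero
    refine (degreeOf_add_le _ _ _).trans (max_le ?_ ?_) <;>
    · refine (degreeOf_pow_le _ _ _).trans ?_
      rw [degreeOf_X, if_neg (by decide), mul_zero]
  have hu' : degreeOf 3 u' = 0 := by
    apply Nat.eq_zero_of_le_zero
    refine (degreeOf_add_le _ _ _).trans (max_le ?_ ?_)
    · refine (degreeOf_mul_le _ _ _).trans ?_
      rw [degreeOf_C, zero_add]
      refine (degreeOf_pow_le _ _ _).trans ?_
      rw [degreeOf_X, if_neg (by decide), mul_zero]
    · refine (degreeOf_pow_le _ _ _).trans ?_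
      rw [hφdeg, mul_zero]
  have h3 := FedderViaSlicing.coeff_X_pow_add_pow 3 7 2 0 (by norm_num) (by norm_num) u' hu' (Finsupp.single 0 4) (by simp)
  rw [Nat.mul_zero, Finsupp.single_zero, zero_add, ← hu3, Nat.choose_zero_right, Nat.cast_one, one_mul, Nat.sub_zero] at h3
  rw [h3]
  -- kill `y` (`Y₁`), then `x⁵`
  have hdvd : (X 1 : MvPolynomial (Fin 4) (MvPolynomial (Fin 1) k)) ^ 1 ∣ u' - (C a * X 0 ^ 2 + X 0 ^ 9) :=
    ⟨X 1 * (X 1 ^ 4 + 3 * X 1 ^ 2 * X 0 ^ 3 + 3 * X 0 ^ 6), by rw [hu'_def]; ring⟩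
  rw [T4PlusFedderData.coeff_pow_eq_of_X_pow_dvd_sub (Finsupp.single 0 4) 1 1 (by simp) hdvd 2]
  have hsq : ((C a * X 0 ^ 2 + X 0 ^ 9) ^ 2 : MvPolynomial (Fin 4) (MvPolynomial (Fin 1) k)) =
      C (a ^ 2) * X 0 ^ 4 + X 0 ^ 5 * (2 * C a * X 0 ^ 6 + X 0 ^ 13) := by
    rw [map_pow]; ring
  rw [hsq, coeff_add, HFedderCertificates.coeff_X_pow_mul_eq_zero _ 0 5 (by simp), add_zero, X_pow_eq_monomial, coeff_C_mul,
    coeff_monomial, if_pos rfl, mul_one]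

/-- **Along `C`: the `z⁴t⁴w⁰`-coefficient of `g⁴` is `12·x²·φ³`.**  In `k[x,y][Z,W,T]` (`Z,W,T = Y₀,Y₁,Y₂`) with `G = Z² + u`,
`u = C(x²)T⁴ + C(φ³) + W⁷`: binomial in `Z` (`C(4,2) = 6`), binomial in `W` (`i = 0`), and
`(C(x²)T⁴ + C(φ³))² = C(x⁴)T⁸ + C(2x²φ³)T⁴ + C(φ⁶)`. [folklore] -/
theorem coeff_along_C (k : Type) [Field k] (a b : MvPolynomial (Fin 2) k) :
    coeff (Finsupp.single (0 : Fin 3) (2 * 2) + Finsupp.single 2 4)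
      ((X 0 ^ 2 + (C a * X 2 ^ 4 + C b + X 1 ^ 7) : MvPolynomial (Fin 3) (MvPolynomial (Fin 2) k)) ^ 4) =
        6 * (2 * a * b) := by
  set u : MvPolynomial (Fin 3) (MvPolynomial (Fin 2) k) := C a * X 2 ^ 4 + C b + X 1 ^ 7 with hu_def
  have hu : degreeOf 0 u = 0 := by
    apply Nat.eq_zero_of_le_zero
    refine (degreeOf_add_le _ _ _).trans (max_le ((degreeOf_add_le _ _ _).trans (max_le ?_ ?_)) ?_)
    · refine (degreeOf_mul_le _ _ _).trans ?_
      rw [degreeOf_C, zero_add]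
      refine (degreeOf_pow_le _ _ _).trans ?_
      rw [degreeOf_X, if_neg (by decide), mul_zero]
    · rw [degreeOf_C]
    · refine (degreeOf_pow_le _ _ _).trans ?_
      rw [degreeOf_X, if_neg (by decide), mul_zero]
  rw [FedderViaSlicing.coeff_X_pow_add_pow 0 2 4 2 (by norm_num) (by norm_num) u hu _ (by simp),
    show (4 - 2 : ℕ) = 2 from rfl, show (Nat.choose 4 2 : MvPolynomial (Fin 2) k) = 6 by norm_num [Nat.choose]]
  congr 1
  set u' : MvPolynomial (Fin 3) (MvPolynomial (Fin 2) k) := C a * X 2 ^ 4 + C b with hu'_def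
  have hu1 : u = X 1 ^ 7 + u' := by rw [hu_def, hu'_def]; ring
  have hu' : degreeOf 1 u' = 0 := by
    apply Nat.eq_zero_of_le_zero
    refine (degreeOf_add_le _ _ _).trans (max_le ?_ ?_)
    · refine (degreeOf_mul_le _ _ _).trans ?_
      rw [degreeOf_C, zero_add]
      refine (degreeOf_pow_le _ _ _).trans ?_
      rw [degreeOf_X, if_neg (by decide), mul_zero]
    · rw [degreeOf_C]
  have h1 := FedderViaSlicing.coeff_X_pow_add_pow 1 7 2 0 (by norm_num) (by norm_num) u' hu' (Finsupp.single 2 4) (by simp)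
  rw [Nat.mul_zero, Finsupp.single_zero, zero_add, ← hu1, Nat.choose_zero_right, Nat.cast_one, one_mul, Nat.sub_zero] at h1
  rw [h1]
  have hsq : (u' ^ 2 : MvPolynomial (Fin 3) (MvPolynomial (Fin 2) k)) =
      X 2 ^ 5 * (C (a ^ 2) * X 2 ^ 3) + C (2 * a * b) * X 2 ^ 4 + C (b ^ 2) := by
    rw [hu'_def, map_pow, map_pow, map_mul, map_mul, map_ofNat]; ring
  rw [hsq, coeff_add, coeff_add, HFedderCertificates.coeff_X_pow_mul_eq_zero _ 2 5 (by simp), zero_add, X_pow_eq_monomial,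
    coeff_C_mul, coeff_monomial, if_pos rfl, mul_one, coeff_C, if_neg, add_zero]
  rw [eq_comm, Finsupp.single_eq_zero]
  norm_num

/-! ## The off-origin clause -/

/-- **THE OFF-ORIGIN CLAUSE `hoff` FOR `g = z² + x²t⁴ + (y² + x³)³ + w⁷` AT `p = 5`**: at every maximal ideal `Q` of `k[X]/(g)` missing
some `x̄ⱼ`, the local ring satisfies the Cohen–Macaulay + Frobenius-closed clause — Jacobian off `L ∪ C`, Fedder through the axis
slicing along `L ∖ 0` (`6t⁸`) and through the plane slicing along `C ∖ 0` (`12x²φ³`, point-unit variant). [cite: Fedder1983, Thm. 1.12]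
[cite: Matsumura1987, Thm. 30.4 (ii)] -/
theorem gxz_offOrigin_clause_char5 (k : Type) [Field k] [CharP k 5] (g : MvPolynomial (Fin 5) k)
    (hg : g = X 2 ^ 2 + X 0 ^ 2 * X 4 ^ 4 + (X 1 ^ 2 + X 0 ^ 3) ^ 3 + X 3 ^ 7) :
    ∀ (Q : Ideal (MvPolynomial (Fin 5) k ⧸ Ideal.span {g})) [Q.IsMaximal],
      (∃ j : Fin 5, Ideal.Quotient.mk (Ideal.span {g}) (MvPolynomial.X j) ∉ Q) →
      ∀ d : ℕ, ringKrullDim (Localization.AtPrime Q) = d → ∀ s : Fin d → Localization.AtPrime Q,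
        (Ideal.span (Set.range s)).radical.IsMaximal →
          RingTheory.Sequence.IsWeaklyRegular (Localization.AtPrime Q) (List.ofFn s) ∧
          ∀ y : Localization.AtPrime Q, (∃ e : ℕ, y ^ 5 ^ e ∈ Ideal.span
            ((fun z : Localization.AtPrime Q => z ^ 5 ^ e) ''
              (Ideal.span (Set.range s) : Set (Localization.AtPrime Q)))) → y ∈ Ideal.span (Set.range s) := by
  haveI : Fact (Nat.Prime 5) := ⟨by norm_num⟩
  intro Q _ hj d hd s hs
  haveI hPmax : (Q.comap (Ideal.Quotient.mk (Ideal.span {g}))).IsMaximal :=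
    Ideal.comap_isMaximal_of_surjective _ Ideal.Quotient.mk_surjective
  have hP := hPmax.isPrime
  have hg0 : g ≠ 0 := hg ▸ GxzData.g_ne_zero k
  -- units in characteristic `5`
  have hu2 : IsUnit (2 : MvPolynomial (Fin 5) k) := by simpa using G5wConeClause.isUnit_natCast_of_not_dvd 5 k 2 (by decide)
  have hu4 : IsUnit (4 : MvPolynomial (Fin 5) k) := by simpa using G5wConeClause.isUnit_natCast_of_not_dvd 5 k 4 (by decide)
  have hu6 : IsUnit (6 : MvPolynomial (Fin 5) k) := by simpa using G5wConeClause.isUnit_natCast_of_not_dvd 5 k 6 (by decide)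
  have hu7 : IsUnit (7 : MvPolynomial (Fin 5) k) := by simpa using G5wConeClause.isUnit_natCast_of_not_dvd 5 k 7 (by decide)
  have hu9 : IsUnit (9 : MvPolynomial (Fin 5) k) := by simpa using G5wConeClause.isUnit_natCast_of_not_dvd 5 k 9 (by decide)
  -- partial derivatives
  have hd0 : pderiv 0 g = 2 * X 0 * X 4 ^ 4 + 9 * X 0 ^ 2 * (X 1 ^ 2 + X 0 ^ 3) ^ 2 := by rw [hg, GxzData.pderiv_zero_gxz]
  have hd1 : pderiv 1 g = 6 * X 1 * (X 1 ^ 2 + X 0 ^ 3) ^ 2 := by rw [hg, GxzData.pderiv_one_gxz]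
  have hd2 : pderiv 2 g = 2 * X 2 := by rw [hg, GxzData.pderiv_two_gxz]
  have hd3 : pderiv 3 g = 7 * X 3 ^ 6 := by rw [hg, GxzData.pderiv_three_gxz]
  have hd4 : pderiv 4 g = 4 * X 0 ^ 2 * X 4 ^ 3 := by rw [hg, GxzData.pderiv_four_gxz]
  -- Jacobian exits
  by_cases m2 : pderiv 2 g ∈ Q.comap (Ideal.Quotient.mk (Ideal.span {g})); swap
  · exact ClauseOfPderivNotMem.stub_clauseOfPderivNotMem 5 k 5 g Q 2 m2 d hd s hs
  by_cases m3 : pderiv 3 g ∈ Q.comap (Ideal.Quotient.mk (Ideal.span {g})); swap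
  · exact ClauseOfPderivNotMem.stub_clauseOfPderivNotMem 5 k 5 g Q 3 m3 d hd s hs
  by_cases m4 : pderiv 4 g ∈ Q.comap (Ideal.Quotient.mk (Ideal.span {g})); swap
  · exact ClauseOfPderivNotMem.stub_clauseOfPderivNotMem 5 k 5 g Q 4 m4 d hd s hs
  by_cases m1 : pderiv 1 g ∈ Q.comap (Ideal.Quotient.mk (Ideal.span {g})); swap
  · exact ClauseOfPderivNotMem.stub_clauseOfPderivNotMem 5 k 5 g Q 1 m1 d hd s hs
  by_cases m0 : pderiv 0 g ∈ Q.comap (Ideal.Quotient.mk (Ideal.span {g})); swap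
  · exact ClauseOfPderivNotMem.stub_clauseOfPderivNotMem 5 k 5 g Q 0 m0 d hd s hs
  -- all partials in `P`: `P ⊇ I(L)` or `P ⊇ I(C)`
  have hX2 : (X 2 : MvPolynomial (Fin 5) k) ∈ Q.comap (Ideal.Quotient.mk (Ideal.span {g})) := by
    rw [hd2] at m2
    exact (Ideal.unit_mul_mem_iff_mem _ hu2).mp m2
  have hX3 : (X 3 : MvPolynomial (Fin 5) k) ∈ Q.comap (Ideal.Quotient.mk (Ideal.span {g})) := by
    rw [hd3] at m3
    exact hP.mem_of_pow_mem 6 ((Ideal.unit_mul_mem_iff_mem _ hu7).mp m3)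
  rw [hd4, mul_assoc] at m4
  rw [hd1, mul_assoc] at m1
  rw [hd0] at m0
  -- not all variables lie in `P`
  have hnot : ¬ ((X 0 : MvPolynomial (Fin 5) k) ∈ Q.comap (Ideal.Quotient.mk (Ideal.span {g})) ∧
      (X 1 : MvPolynomial (Fin 5) k) ∈ Q.comap (Ideal.Quotient.mk (Ideal.span {g})) ∧
      (X 4 : MvPolynomial (Fin 5) k) ∈ Q.comap (Ideal.Quotient.mk (Ideal.span {g}))) := by
    rintro ⟨h0, h1, h4⟩
    obtain ⟨j, hj⟩ := hj
    apply hj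
    fin_cases j
    · exact Ideal.mem_comap.mp h0
    · exact Ideal.mem_comap.mp h1
    · exact Ideal.mem_comap.mp hX2
    · exact Ideal.mem_comap.mp hX3
    · exact Ideal.mem_comap.mp h4
  by_cases hX0 : (X 0 : MvPolynomial (Fin 5) k) ∈ Q.comap (Ideal.Quotient.mk (Ideal.span {g}))
  · /- CASE `L`: `x ∈ P` ⇒ `y ∈ P` (from `∂₁`), so `P ⊇ (x,y,z,w)` and `t ∉ P` -/
    have hX1 : (X 1 : MvPolynomial (Fin 5) k) ∈ Q.comap (Ideal.Quotient.mk (Ideal.span {g})) := by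
      rcases hP.mem_or_mem ((Ideal.unit_mul_mem_iff_mem _ hu6).mp m1) with h1 | h1
      · exact h1
      · have hφ := hP.mem_of_pow_mem 2 h1
        refine hP.mem_of_pow_mem 2 ?_
        have e : (X 1 ^ 2 : MvPolynomial (Fin 5) k) = (X 1 ^ 2 + X 0 ^ 3) - X 0 * X 0 ^ 2 := by ring
        rw [e]
        exact Ideal.sub_mem _ hφ (Ideal.mul_mem_right _ _ hX0)
    have hX4 : (X 4 : MvPolynomial (Fin 5) k) ∉ Q.comap (Ideal.Quotient.mk (Ideal.span {g})) :=
      fun h4 => hnot ⟨hX0, hX1, h4⟩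
    -- the axis slicing (base `k[t]`; slices `x, y, z, w`)
    obtain ⟨Ψ, hΨ0, hΨ1, hΨ2, hΨ3, hΨ4⟩ := exists_axisSlicing5 k
    have hy0 : Ψ.symm (X 0) = X 0 := Ψ.symm_apply_eq.mpr hΨ0.symm
    have hy1 : Ψ.symm (X 1) = X 1 := Ψ.symm_apply_eq.mpr hΨ1.symm
    have hy2 : Ψ.symm (X 2) = X 2 := Ψ.symm_apply_eq.mpr hΨ2.symm
    have hy3 : Ψ.symm (X 3) = X 3 := Ψ.symm_apply_eq.mpr hΨ3.symm
    have hb0 : Ψ.symm (C (X 0)) = X 4 := Ψ.symm_apply_eq.mpr hΨ4.symm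
    have hy : ∀ r : Fin 4, Ψ.symm (X r) ∈ Q.comap (Ideal.Quotient.mk (Ideal.span {g})) := by
      intro r
      fin_cases r
      · exact hy0 ▸ hX0
      · exact hy1 ▸ hX1
      · exact hy2 ▸ hX2
      · exact hy3 ▸ hX3
    have hΨg : Ψ g = X 2 ^ 2 + (C (X 0 ^ 4) * X 0 ^ 2 + (X 1 ^ 2 + X 0 ^ 3) ^ 3 + X 3 ^ 7) := by
      rw [hg]
      simp only [map_add, map_mul, map_pow, hΨ0, hΨ1, hΨ2, hΨ3, hΨ4]
      ring
    have hcoeff : coeff (Finsupp.single (2 : Fin 4) (2 * 2) + Finsupp.single 0 4) (Ψ (g ^ (5 - 1))) =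
        6 * (X 0 ^ 8) ^ 1 := by
      rw [map_pow, hΨg, show (5 - 1 : ℕ) = 4 from rfl, coeff_along_L, pow_one, ← pow_mul]
    have hu : IsUnit (6 : MvPolynomial (Fin 1) k) := by simpa using G5wConeClause.isUnit_natCast_of_not_dvd 5 k 6 (by decide)
    have hdslice : ∀ r : Fin 4, (Finsupp.single (2 : Fin 4) (2 * 2) + Finsupp.single 0 4 : Fin 4 →₀ ℕ) r < 5 := by
      intro r
      fin_cases r <;> simp
    -- `t⁸ ∉ 𝔭`
    have ht8 : (X 0 ^ 8 : MvPolynomial (Fin 1) k) ∉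
        (Q.comap (Ideal.Quotient.mk (Ideal.span {g}))).comap (Ψ.symm.toRingHom.comp C) := by
      intro h8
      haveI : ((Q.comap (Ideal.Quotient.mk (Ideal.span {g}))).comap (Ψ.symm.toRingHom.comp C)).IsPrime :=
        Ideal.comap_isPrime _ _
      have h1 := Ideal.mem_comap.mp (Ideal.IsPrime.mem_of_pow_mem ‹_› 8 h8)
      rw [RingHom.comp_apply, RingEquiv.toRingHom_eq_coe, RingEquiv.coe_toRingHom, hb0] at h1
      exact hX4 h1
    exact FedderViaSlicing.clause_of_sliceCoeff 5 k Ψ g hg0 Q hy _ hdslice _ (X 0 ^ 8) hu 1 (by norm_num) hcoeff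
      (Or.inl ht8) d hd s hs
  · /- CASE `C`: `x ∉ P` ⇒ `t ∈ P` (from `∂₄`), `φ ∈ P` (from `∂₀`), `y ∉ P` -/
    have hX4 : (X 4 : MvPolynomial (Fin 5) k) ∈ Q.comap (Ideal.Quotient.mk (Ideal.span {g})) := by
      rcases hP.mem_or_mem ((Ideal.unit_mul_mem_iff_mem _ hu4).mp m4) with h | h
      · exact absurd (hP.mem_of_pow_mem 2 h) hX0
      · exact hP.mem_of_pow_mem 3 h
    have hφ : (X 1 ^ 2 + X 0 ^ 3 : MvPolynomial (Fin 5) k) ∈ Q.comap (Ideal.Quotient.mk (Ideal.span {g})) := by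
      -- `∂₀ = x·(2t⁴ + 9xφ²)`, `x ∉ P`, `t ∈ P`
      have h1 : (X 0 * (2 * X 4 ^ 4 + 9 * X 0 * (X 1 ^ 2 + X 0 ^ 3) ^ 2) : MvPolynomial (Fin 5) k) ∈
          Q.comap (Ideal.Quotient.mk (Ideal.span {g})) := by
        have e : (X 0 * (2 * X 4 ^ 4 + 9 * X 0 * (X 1 ^ 2 + X 0 ^ 3) ^ 2) : MvPolynomial (Fin 5) k) =
            2 * X 0 * X 4 ^ 4 + 9 * X 0 ^ 2 * (X 1 ^ 2 + X 0 ^ 3) ^ 2 := by ring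
        rw [e]; exact m0
      rcases hP.mem_or_mem h1 with h | h
      · exact absurd h hX0
      · have h2 : (9 * X 0 * (X 1 ^ 2 + X 0 ^ 3) ^ 2 : MvPolynomial (Fin 5) k) ∈ Q.comap (Ideal.Quotient.mk (Ideal.span {g})) := by
          have e : (9 * X 0 * (X 1 ^ 2 + X 0 ^ 3) ^ 2 : MvPolynomial (Fin 5) k) =
              (2 * X 4 ^ 4 + 9 * X 0 * (X 1 ^ 2 + X 0 ^ 3) ^ 2) - 2 * X 4 ^ 3 * X 4 := by ring
          rw [e]
          exact Ideal.sub_mem _ h (Ideal.mul_mem_left _ _ hX4)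
        rw [mul_assoc] at h2
        rcases hP.mem_or_mem ((Ideal.unit_mul_mem_iff_mem _ hu9).mp h2) with h3 | h3
        · exact absurd h3 hX0
        · exact hP.mem_of_pow_mem 2 h3
    have hX1 : (X 1 : MvPolynomial (Fin 5) k) ∉ Q.comap (Ideal.Quotient.mk (Ideal.span {g})) := by
      intro h1
      apply hX0
      refine hP.mem_of_pow_mem 3 ?_
      have e : (X 0 ^ 3 : MvPolynomial (Fin 5) k) = (X 1 ^ 2 + X 0 ^ 3) - X 1 * X 1 := by ring
      rw [e]
      exact Ideal.sub_mem _ hφ (Ideal.mul_mem_left _ _ h1)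
    -- the plane slicing (base `k[x,y]`; slices `z, w, t`)
    obtain ⟨Ψ, hΨ0, hΨ1, hΨ2, hΨ3, hΨ4⟩ := exists_planeSlicing5 k
    have hy0 : Ψ.symm (X 0) = X 2 := Ψ.symm_apply_eq.mpr hΨ2.symm
    have hy1 : Ψ.symm (X 1) = X 3 := Ψ.symm_apply_eq.mpr hΨ3.symm
    have hy2 : Ψ.symm (X 2) = X 4 := Ψ.symm_apply_eq.mpr hΨ4.symm
    have hb0 : Ψ.symm (C (X 0)) = X 0 := Ψ.symm_apply_eq.mpr hΨ0.symm
    have hb1 : Ψ.symm (C (X 1)) = X 1 := Ψ.symm_apply_eq.mpr hΨ1.symm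
    have hy : ∀ r : Fin 3, Ψ.symm (X r) ∈ Q.comap (Ideal.Quotient.mk (Ideal.span {g})) := by
      intro r
      fin_cases r
      · exact hy0 ▸ hX2
      · exact hy1 ▸ hX3
      · exact hy2 ▸ hX4
    have hΨg : Ψ g = X 0 ^ 2 + (C (X 0 ^ 2) * X 2 ^ 4 + C ((X 1 ^ 2 + X 0 ^ 3) ^ 3) + X 1 ^ 7) := by
      rw [hg]
      simp only [map_add, map_mul, map_pow, hΨ0, hΨ1, hΨ2, hΨ3, hΨ4]
      ring
    have hcoeff : coeff (Finsupp.single (0 : Fin 3) (2 * 2) + Finsupp.single 2 4) (Ψ (g ^ (5 - 1))) =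
        (12 * X 0 ^ 2) * (X 1 ^ 2 + X 0 ^ 3) ^ 3 := by
      rw [map_pow, hΨg, show (5 - 1 : ℕ) = 4 from rfl, coeff_along_C]
      ring
    have hdslice : ∀ r : Fin 3, (Finsupp.single (0 : Fin 3) (2 * 2) + Finsupp.single 2 4 : Fin 3 →₀ ℕ) r < 5 := by
      intro r
      fin_cases r <;> simp
    haveI h𝔭 : ((Q.comap (Ideal.Quotient.mk (Ideal.span {g}))).comap (Ψ.symm.toRingHom.comp C)).IsPrime :=
      Ideal.comap_isPrime _ _
    -- `12x² ∉ 𝔭`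
    have hu : (12 * X 0 ^ 2 : MvPolynomial (Fin 2) k) ∉
        (Q.comap (Ideal.Quotient.mk (Ideal.span {g}))).comap (Ψ.symm.toRingHom.comp C) := by
      intro h12
      have hu12 : IsUnit (12 : MvPolynomial (Fin 2) k) := by
        simpa using G5wConeClause.isUnit_natCast_of_not_dvd 5 k 12 (by decide)
      have h1 := Ideal.mem_comap.mp (h𝔭.mem_of_pow_mem 2 ((Ideal.unit_mul_mem_iff_mem _ hu12).mp h12))
      rw [RingHom.comp_apply, RingEquiv.toRingHom_eq_coe, RingEquiv.coe_toRingHom, hb0] at h1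
      exact hX0 h1
    -- `∂φ/∂y = 2y ∉ 𝔭`
    have hdn : pderiv 1 (X 1 ^ 2 + X 0 ^ 3 : MvPolynomial (Fin 2) k) ∉
        (Q.comap (Ideal.Quotient.mk (Ideal.span {g}))).comap (Ψ.symm.toRingHom.comp C) := by
      have e : pderiv 1 (X 1 ^ 2 + X 0 ^ 3 : MvPolynomial (Fin 2) k) = 2 * X 1 := by
        simp only [map_add, pderiv_pow, pderiv_X_self, pderiv_X_of_ne (show (0 : Fin 2) ≠ 1 by decide)]
        norm_num
      rw [e]
      intro h2
      have hu2' : IsUnit (2 : MvPolynomial (Fin 2) k) := by simpa using G5wConeClause.isUnit_natCast_of_not_dvd 5 k 2 (by decide)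
      have h1 := Ideal.mem_comap.mp ((Ideal.unit_mul_mem_iff_mem _ hu2').mp h2)
      rw [RingHom.comp_apply, RingEquiv.toRingHom_eq_coe, RingEquiv.coe_toRingHom, hb1] at h1
      exact hX1 h1
    exact FedderViaSlicingNotMem.clause_of_sliceCoeff_of_not_mem 5 k Ψ g hg0 Q hy _ hdslice _ (X 1 ^ 2 + X 0 ^ 3) hu 3
      (by norm_num) hcoeff (Or.inr ⟨1, hdn⟩) d hd s hs

end Summit.ResolutionOfSingularities.ResolutionOfSingularities.Theorems.FInjectiveMacaulayfication.GxzOffOrigin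

end
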